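import Summits.PneNP.PneNP.Theorems.ConvexRankGatesConvexGateBlindExactLiftingRankCornerCore

/-!
# The rank corner of `ExactLifting`: `t³ ≤ q² + r`, hence the stub holds with the bounded exponent `φ ≡ 1`

Support file for crux `ConvexGateBlind` (stmt-PneNP-10680), line `xor-door-perfect-completeness`, open stub
`stub_exactLifting : XorDoor.ExactLifting` (lead c3).

`ExactLifting` asks for an UNBOUNDED exponent `φ` such that every `(PSD_q ⊕ ℝ^r_{≥0})`-factorisation of the
shifted Index-lift `(x, w) ↦ viol_F(x[w]) − ε` of an unsatisfiable, degree-`d` perfectly fooled 3-sparse system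
`F` has `q + r ≥ t^{φ(d)}` for `t ≥ T(m, d, F)`, uniformly in `ε > 0`.  This file proves the only lower bound
the statement is presently known to satisfy, in the strongest form the argument gives:

* `RankCorner.rank_corner_of_goodTriple` — if `F` contains an equation on three DISTINCT variables
  `i, j, l` and all equations of `F` on `{i, j, l}` have the same right-hand side, then for EVERY gadget size
  `t`, EVERY real shift `ε` and every cone factorisation of the shifted lift, `t³ ≤ q·q + r`.  Proof: the
  `t³` columns `w` agreeing with a fixed pointer off `{i, j, l}` are linearly independent real functions of
  the string table `x` — the character sums `Λ_π(f) = Σ_x χ_π(x) f(x)` over the three bits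
  `(i,π₁), (j,π₂), (l,π₃)` are a dual family (core file) — while every column of a `(q, r)`-factorisation
  lies in the span of the `q² + r` functions `x ↦ (H x)_{ab}`, `x ↦ U_{x,l}` (only the bilinear shape of
  the factorisation is used, no positivity).
* `RankCorner.exists_genuine_of_perfect`, `RankCorner.sameRhs_of_perfect` — an unsatisfiable system with a
  degree-`d ≥ 3` perfect-completeness pseudo-expectation has such a triple (an all-unit unsatisfiable system
  has a clash `y_a = 0, y_a = 1`; a clash or a complementary pair forces `Ẽ[viol_F] ≥ Ẽ[1] = 1`).
* `exactLifting_rank_corner` — combined: under the hypotheses of `ExactLifting` (and `3 ≤ d`),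
  `t³ ≤ q·q + r` for every `t`, every real `ε`, every cone factorisation.
* `exactLifting_exponent_one` — consequently `t ≤ q + r`: `ExactLifting` with `φ d` replaced by `1`
  (for `d ≥ 3`, threshold `T = 0`, all real `ε`).  So the open stub is exactly the demand to raise the
  exponent above the rank corner uniformly in `ε > 0`; by the sibling calibration files it can be raised at
  most to the Sherali–Adams degree (LP part) / the junta-SOS degree (PSD part) of the fooled system.

Elementary linear algebra over `ℝ` (Mathlib `linearIndependent_le_span_aux'`); no citation needed.
-/

set_option linter.dupNamespace false -- `Summit.PneNP.PneNP.…`: summit = sub-problem (D-0017)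

namespace Summit.PneNP.PneNP.Theorems.XorDoor

open scoped BigOperators Classical
open Finset

noncomputable section

namespace RankCorner

variable {m t : ℕ}

/-! ## §5 Linear independence of `t³` columns and the rank corner -/

/-- **The `t³` columns through a good triple are linearly independent** (for every real shift `ε`). -/
theorem linearIndependent_col {F : Finset (Pool m)} {i j l : Fin m} (hij : i ≠ j) (hil : i ≠ l)
    (hjl : j ≠ l) (hex : ∃ e ∈ F, idx e = {i, j, l})
    (hrhs : ∀ e ∈ F, ∀ e' ∈ F, idx e = {i, j, l} → idx e' = {i, j, l} → e.2.2.2 = e'.2.2.2)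
    (ε : ℝ) : LinearIndependent ℝ (fun π : Fin t × Fin t × Fin t => col F ε (ptrOf i j l π)) := by
  rw [linearIndependent_iff']
  intro s g hsum π hπ
  -- apply the functional `Λ_{ptrOf π}` to the vanishing combination
  have h0 : Lam i j l (ptrOf i j l π) 0 = 0 := by unfold Lam; simp
  have happ := congrArg (Lam i j l (ptrOf i j l π)) hsum
  rw [h0] at happ
  have hlin : Lam i j l (ptrOf i j l π) (∑ π' ∈ s, g π' • col F ε (ptrOf i j l π')) =
      ∑ π' ∈ s, g π' * Lam i j l (ptrOf i j l π) (col F ε (ptrOf i j l π')) := by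
    unfold Lam
    simp only [Finset.sum_apply, Pi.smul_apply, smul_eq_mul, Finset.mul_sum]
    rw [Finset.sum_comm]
    refine Finset.sum_congr rfl fun π' _ => Finset.sum_congr rfl fun x _ => ?_
    ring
  rw [hlin, Finset.sum_eq_single π] at happ
  · exact (mul_eq_zero.1 happ).resolve_right (Lam_col_self_ne_zero hij hil hjl hex hrhs ε _)
  · intro π' _ hne
    obtain ⟨a, ha, hane⟩ := exists_ptrOf_ne hij hil hjl hne
    rw [Lam_col_eq_zero hij hil hjl F ε ha hane, mul_zero]
  · intro h
    exact absurd hπ h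

/-- **Rank corner from a good triple.** For every gadget size `t`, every real shift `ε` and every
`(PSD_q ⊕ ℝ^r_{≥0})`-factorisation of the shifted Index-lift, `t³ ≤ q·q + r` (only the bilinear shape of
the factorisation is used, not positivity). -/
theorem rank_corner_of_goodTriple {F : Finset (Pool m)} {i j l : Fin m} (hij : i ≠ j) (hil : i ≠ l)
    (hjl : j ≠ l) (hex : ∃ e ∈ F, idx e = {i, j, l})
    (hrhs : ∀ e ∈ F, ∀ e' ∈ F, idx e = {i, j, l} → idx e' = {i, j, l} → e.2.2.2 = e'.2.2.2)
    (t : ℕ) (ε : ℝ) (q r : ℕ)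
    (hfact : HasConeFact (fun (x : Fin m → Fin t → ZMod 2) (w : Fin m → Fin t) =>
      (viol F (fun i => x i (w i)) : ℝ) - ε) q r) :
    t ^ 3 ≤ q * q + r := by
  obtain ⟨H, Y, U, V, -, -, -, -, hM⟩ := hfact
  -- the `q² + r` generating functions of the string table
  let gen : (Fin q × Fin q) ⊕ Fin r → (Fin m → Fin t → ZMod 2) → ℝ :=
    Sum.elim (fun ab x => H x ab.1 ab.2) (fun l' x => U x l')
  -- every column lies in their span
  have hmem : ∀ w : Fin m → Fin t, col F ε w ∈ Submodule.span ℝ (Set.range gen) := by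
    intro w
    have hcol : col F ε w = ∑ ab : Fin q × Fin q, (Y w ab.2 ab.1) • gen (Sum.inl ab) +
        ∑ l', (V l' w) • gen (Sum.inr l') := by
      funext x
      have hMxw : (viol F (fun i => x i (w i)) : ℝ) - ε = (H x * Y w).trace + ∑ l, U x l * V l w :=
        hM x w
      show (viol F (fun i => x i (w i)) : ℝ) - ε = _
      rw [hMxw]
      simp only [Pi.add_apply, Finset.sum_apply, Pi.smul_apply, smul_eq_mul, gen, Sum.elim_inl,
        Sum.elim_inr, Matrix.trace, Matrix.diag_apply, Matrix.mul_apply]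
      rw [Fintype.sum_prod_type]
      congr 1
      · refine Finset.sum_congr rfl fun a _ => Finset.sum_congr rfl fun b _ => ?_
        ring
      · refine Finset.sum_congr rfl fun l' _ => ?_
        ring
    rw [hcol]
    refine Submodule.add_mem _ (Submodule.sum_mem _ fun ab _ => ?_)
      (Submodule.sum_mem _ fun l' _ => ?_)
    · exact Submodule.smul_mem _ _ (Submodule.subset_span (Set.mem_range_self _))
    · exact Submodule.smul_mem _ _ (Submodule.subset_span (Set.mem_range_self _))
  have hrange : Set.range (fun π : Fin t × Fin t × Fin t => col F ε (ptrOf i j l π)) ≤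
      Submodule.span ℝ (Set.range gen) := by
    rintro f ⟨π, rfl⟩
    exact hmem _
  have h := linearIndependent_le_span_aux' _ (linearIndependent_col hij hil hjl hex hrhs ε)
    (Set.range gen) hrange
  have hcardι : Fintype.card (Fin t × Fin t × Fin t) = t ^ 3 := by
    simp only [Fintype.card_prod, Fintype.card_fin]
    ring
  have hcardw : Fintype.card (Set.range gen) ≤ q * q + r := by
    refine (Fintype.card_range_le gen).trans ?_
    simp only [Fintype.card_sum, Fintype.card_prod, Fintype.card_fin]
    exact le_rfl
  rw [hcardι] at h
  exact h.trans hcardw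

/-! ## §6 Fooled systems have a good triple -/

/-- The violation count of any system has non-negative pseudo-expectation (each violation indicator is a
non-negative 3-junta; needs `3 ≤ d`). -/
theorem pseudoExp_viol_nonneg {m d : ℕ} (hd : 3 ≤ d) (E : ((Fin m → ZMod 2) → ℝ) →ₗ[ℝ] ℝ)
    (hSA : ∀ h : (Fin m → ZMod 2) → ℝ, IsJunta d h → (∀ x, 0 ≤ h x) → 0 ≤ E h)
    (G : Finset (Pool m)) : 0 ≤ E (fun y => (viol G y : ℝ)) := by
  have hexp : (fun y => (viol G y : ℝ)) =
      ∑ e ∈ G, fun y => if y e.1 + y e.2.1 + y e.2.2.1 = e.2.2.2 then (0 : ℝ) else 1 := by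
    funext y
    rw [Finset.sum_apply, viol, Finset.card_filter]
    push_cast
    refine sum_congr rfl fun e _ => ?_
    by_cases h : y e.1 + y e.2.1 + y e.2.2.1 = e.2.2.2 <;> simp [Sat, h]
  rw [hexp, map_sum]
  refine Finset.sum_nonneg fun e _ => hSA _ ⟨idx e, (card_idx_le e).trans hd, ?_⟩ ?_
  · intro x y hxy
    simp only [idx, Finset.mem_insert, Finset.mem_singleton, forall_eq_or_imp, forall_eq] at hxy
    simp only [hxy.1, hxy.2.1, hxy.2.2]
  · intro x
    split_ifs <;> norm_num

/-- **Two equations that are never satisfied together are incompatible with a perfect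
pseudo-expectation** (`3 ≤ d`): `viol_F = 1 + viol_{F ∖ {e,e'}}` as functions, so
`Ẽ[viol_F] ≥ Ẽ[1] = 1`. -/
theorem not_perfect_of_exclusive {m d : ℕ} (hd : 3 ≤ d) {F : Finset (Pool m)} {e e' : Pool m}
    (he : e ∈ F) (he' : e' ∈ F) (hne : e ≠ e') (hex : ∀ y, Sat y e ↔ ¬ Sat y e') :
    ¬ HasPerfectPseudoExp d F := by
  rintro ⟨E, hSA, -, hone, hviol⟩
  set G : Finset (Pool m) := (F.erase e).erase e' with hG
  have hF : F = insert e (insert e' G) := by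
    rw [hG, Finset.insert_erase (Finset.mem_erase.2 ⟨hne.symm, he'⟩), Finset.insert_erase he]
  have heG : e ∉ insert e' G := by
    simp only [hG, Finset.mem_insert, Finset.mem_erase, not_or]
    exact ⟨hne, fun h => h.2.1 rfl⟩
  have he'G : e' ∉ G := by simp [hG]
  have hdecomp : (fun y => (viol F y : ℝ)) = (fun _ => (1 : ℝ)) + fun y => (viol G y : ℝ) := by
    funext y
    simp only [Pi.add_apply]
    unfold viol
    rw [hF, Finset.filter_insert, Finset.filter_insert]
    by_cases hs : Sat y e
    · have hs' : ¬ Sat y e' := (hex y).1 hs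
      rw [if_neg (not_not.2 hs), if_pos hs', Finset.card_insert_of_notMem]
      · push_cast; ring
      · exact fun h => he'G (Finset.mem_filter.1 h).1
    · have hs' : Sat y e' := by
        by_contra h
        exact hs ((hex y).2 h)
      rw [if_pos hs, if_neg (not_not.2 hs'), Finset.card_insert_of_notMem]
      · push_cast; ring
      · exact fun h => heG (Finset.mem_insert_of_mem (Finset.mem_filter.1 h).1)
  have h1 : E (fun y => (viol F y : ℝ)) = 1 + E (fun y => (viol G y : ℝ)) := by
    rw [hdecomp, map_add, hone]
  have h2 := pseudoExp_viol_nonneg hd E hSA G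
  rw [hviol] at h1
  linarith

/-- A repeated-index equation is a unit equation `y a = rhs` for its odd-multiplicity variable `a`
(`y + y = 0` over `𝔽₂`). -/
theorem sat_iff_of_not_distinct {m : ℕ} {e : Pool m}
    (h : ¬ (e.1 ≠ e.2.1 ∧ e.1 ≠ e.2.2.1 ∧ e.2.1 ≠ e.2.2.1)) (y : Fin m → ZMod 2) :
    Sat y e ↔
      y (if e.1 = e.2.1 then e.2.2.1 else if e.1 = e.2.2.1 then e.2.1 else e.1) = e.2.2.2 := by
  have hyy : ∀ a : Fin m, y a + y a = 0 := fun a => by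
    rcases zmod2_cases (y a) with h0 | h1
    · rw [h0, add_zero]
    · rw [h1]; decide
  unfold Sat
  by_cases h12 : e.1 = e.2.1
  · rw [if_pos h12, h12, hyy, zero_add]
  · rw [if_neg h12]
    by_cases h13 : e.1 = e.2.2.1
    · rw [if_pos h13, h13, add_comm (y e.2.2.1) (y e.2.1), add_assoc, hyy, add_zero]
    · rw [if_neg h13]
      have h23 : e.2.1 = e.2.2.1 := by
        by_contra h23
        exact h ⟨h12, h13, h23⟩
      rw [h23, add_assoc, hyy, add_zero]

/-- **A fooled unsatisfiable system has a genuine 3-variable equation** (`3 ≤ d`): an all-unit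
unsatisfiable system contains a clash `y_a = 0, y_a = 1`, excluded by `not_perfect_of_exclusive`. -/
theorem exists_genuine_of_perfect {m d : ℕ} (hd : 3 ≤ d) {F : Finset (Pool m)}
    (hunsat : ¬ ∃ y : Fin m → ZMod 2, ∀ e ∈ F, Sat y e) (hPE : HasPerfectPseudoExp d F) :
    ∃ e ∈ F, e.1 ≠ e.2.1 ∧ e.1 ≠ e.2.2.1 ∧ e.2.1 ≠ e.2.2.1 := by
  by_contra hall
  push Not at hall
  have hunit : ∀ e ∈ F, ¬ (e.1 ≠ e.2.1 ∧ e.1 ≠ e.2.2.1 ∧ e.2.1 ≠ e.2.2.1) :=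
    fun e he h => h.2.2 (hall e he h.1 h.2.1)
  -- every equation is a unit equation `y (odd e) = rhs`
  let odd : Pool m → Fin m := fun e =>
    if e.1 = e.2.1 then e.2.2.1 else if e.1 = e.2.2.1 then e.2.1 else e.1
  have hsat : ∀ e ∈ F, ∀ y : Fin m → ZMod 2, Sat y e ↔ y (odd e) = e.2.2.2 :=
    fun e he y => sat_iff_of_not_distinct (hunit e he) y
  -- either there is a clash, or the system is satisfiable
  by_cases hclash : ∃ e ∈ F, ∃ e' ∈ F, odd e = odd e' ∧ e.2.2.2 ≠ e'.2.2.2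
  · obtain ⟨e, he, e', he', hidx, hrhs⟩ := hclash
    have hne : e ≠ e' := fun h => hrhs (by rw [h])
    refine not_perfect_of_exclusive hd he he' hne (fun y => ?_) hPE
    rw [hsat e he, hsat e' he', hidx]
    have key2 : ∀ a b c : ZMod 2, a ≠ b → (c = a ↔ ¬ c = b) := by decide
    exact key2 _ _ _ hrhs
  · push Not at hclash
    apply hunsat
    refine ⟨fun a => if ∃ e ∈ F, odd e = a ∧ e.2.2.2 = 1 then 1 else 0, fun e he => ?_⟩
    rw [hsat e he]
    rcases zmod2_cases e.2.2.2 with h0 | h1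
    · rw [h0, if_neg]
      rintro ⟨e', he', hidx, h1⟩
      exact absurd (hclash e' he' e he hidx) (by rw [h0, h1]; decide)
    · rw [h1, if_pos ⟨e, he, rfl, h1⟩]

/-- Under a perfect pseudo-expectation (`3 ≤ d`), two equations exactly on the same triple of distinct
variables have the same right-hand side. -/
theorem sameRhs_of_perfect {m d : ℕ} (hd : 3 ≤ d) {F : Finset (Pool m)}
    (hPE : HasPerfectPseudoExp d F) {i j l : Fin m} (hij : i ≠ j) (hil : i ≠ l) (hjl : j ≠ l) :
    ∀ e ∈ F, ∀ e' ∈ F, idx e = {i, j, l} → idx e' = {i, j, l} → e.2.2.2 = e'.2.2.2 := by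
  intro e he e' he' hie hie'
  by_contra hne
  have hee' : e ≠ e' := fun h => hne (by rw [h])
  refine not_perfect_of_exclusive hd he he' hee' (fun y => ?_) hPE
  -- both satisfaction predicates are the same parity test (read through a pointer at `t = 1`)
  have key : ∀ f : Pool m, idx f = {i, j, l} →
      ((y f.1 + y f.2.1 + y f.2.2.1 = f.2.2.2) ↔ (y i + y j + y l = f.2.2.2)) := by
    intro f hf
    have h := vInd_eq_of_idx_eq (t := 1) hij hil hjl hf (fun _ => 0) (fun b _ => y b)
    simp only [vInd, par] at h
    by_cases hc1 : y f.1 + y f.2.1 + y f.2.2.1 = f.2.2.2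
    · by_cases hc2 : y i + y j + y l = f.2.2.2
      · exact ⟨fun _ => hc2, fun _ => hc1⟩
      · rw [if_pos hc1, if_neg hc2] at h
        exact absurd h (by norm_num)
    · by_cases hc2 : y i + y j + y l = f.2.2.2
      · rw [if_neg hc1, if_pos hc2] at h
        exact absurd h (by norm_num)
      · exact ⟨fun h1 => absurd h1 hc1, fun h2 => absurd h2 hc2⟩
  unfold Sat
  rw [key e hie, key e' hie']
  have key2 : ∀ a b c : ZMod 2, a ≠ b → (c = a ↔ ¬ c = b) := by decide
  exact key2 _ _ _ hne

/-- A fooled unsatisfiable system has a good triple. -/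
theorem exists_goodTriple_of_perfect {m d : ℕ} (hd : 3 ≤ d) {F : Finset (Pool m)}
    (hunsat : ¬ ∃ y : Fin m → ZMod 2, ∀ e ∈ F, Sat y e) (hPE : HasPerfectPseudoExp d F) :
    ∃ i j l : Fin m, i ≠ j ∧ i ≠ l ∧ j ≠ l ∧ (∃ e ∈ F, idx e = {i, j, l}) ∧
      ∀ e ∈ F, ∀ e' ∈ F, idx e = {i, j, l} → idx e' = {i, j, l} → e.2.2.2 = e'.2.2.2 := by
  obtain ⟨e, he, h12, h13, h23⟩ := exists_genuine_of_perfect hd hunsat hPE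
  exact ⟨e.1, e.2.1, e.2.2.1, h12, h13, h23, ⟨e, he, rfl⟩, sameRhs_of_perfect hd hPE h12 h13 h23⟩

/-- Arithmetic: `t³ ≤ q² + r` forces `t ≤ q + r`. -/
theorem le_add_of_cube_le {t q r : ℕ} (h : t ^ 3 ≤ q * q + r) : t ≤ q + r := by
  by_cases hq : t ≤ q
  · exact hq.trans (Nat.le_add_right q r)
  · push Not at hq
    have hq1 : q + 1 ≤ t := hq
    have ht1 : 1 ≤ t := le_trans (Nat.le_add_left 1 q) hq1
    have key : q * q + t ≤ t ^ 3 := by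
      have e1 : (q + 1) * (q + 1) * t ≤ t * t * t :=
        Nat.mul_le_mul (Nat.mul_le_mul hq1 hq1) le_rfl
      have e2 : q * q + t ≤ (q + 1) * (q + 1) * t := by
        have : q * q * 1 ≤ q * q * t := Nat.mul_le_mul_left _ ht1
        nlinarith
      calc q * q + t ≤ (q + 1) * (q + 1) * t := e2
        _ ≤ t * t * t := e1
        _ = t ^ 3 := by ring
    omega

end RankCorner

open RankCorner

/-! ## §7 The rank corner and `ExactLifting` with exponent one -/

/-- **Rank corner of `ExactLifting`.** For an unsatisfiable 3-sparse system with a degree-`d ≥ 3`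
perfect-completeness pseudo-expectation: every `(PSD_q ⊕ ℝ^r_{≥0})`-factorisation of ANY real shift of
its Index-lift at ANY gadget size `t` has `t³ ≤ q·q + r`. -/
theorem exactLifting_rank_corner {m d : ℕ} (hd : 3 ≤ d) {F : Finset (Pool m)}
    (hunsat : ¬ ∃ y : Fin m → ZMod 2, ∀ e ∈ F, Sat y e) (hPE : HasPerfectPseudoExp d F)
    (t : ℕ) (ε : ℝ) (q r : ℕ)
    (hfact : HasConeFact (fun (x : Fin m → Fin t → ZMod 2) (w : Fin m → Fin t) =>
      (viol F (fun i => x i (w i)) : ℝ) - ε) q r) :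
    t ^ 3 ≤ q * q + r := by
  obtain ⟨i, j, l, hij, hil, hjl, hex, hrhs⟩ := exists_goodTriple_of_perfect hd hunsat hPE
  exact rank_corner_of_goodTriple hij hil hjl hex hrhs t ε q r hfact

/-- **`ExactLifting` holds with the exponent `φ ≡ 1`** (for `d ≥ 3`; threshold `T = 0`; every real `ε`):
under the hypotheses of the stub, every cone factorisation of every shift of the Index-lift has
`t ≤ q + r`. The open stub `stub_exactLifting` is precisely the demand for an UNBOUNDED exponent here. -/
theorem exactLifting_exponent_one :
    ∀ (m d : ℕ) (F : Finset (Pool m)), 3 ≤ d →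
      (¬ ∃ y : Fin m → ZMod 2, ∀ e ∈ F, Sat y e) → HasPerfectPseudoExp d F →
      ∀ (t : ℕ) (ε : ℝ) (q r : ℕ),
        HasConeFact (fun (x : Fin m → Fin t → ZMod 2) (w : Fin m → Fin t) =>
          (viol F (fun i => x i (w i)) : ℝ) - ε) q r →
        t ^ 1 ≤ q + r := by
  intro m d F hd hunsat hPE t ε q r hfact
  rw [pow_one]
  exact le_add_of_cube_le (exactLifting_rank_corner hd hunsat hPE t ε q r hfact)

end

end Summit.PneNP.PneNP.Theorems.XorDoor
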